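import Summits.BirchSwinnertonDyer.BirchSwinnertonDyer.Theorems.ResidualThetaTransportAtTwoThetaLayerLambdaCongruenceAtTwoCuspSpanPotential
import HarnessLib

/-!
# Route `ResidualThetaTransportAtTwo`, cruxes Kan⁺ (stmt-BirchSwinnertonDyer-20688) / node 27436 / 21437: the MOVES of the potential
# at the cusps `1/w` coming from the `4^k`-classes — level-free tools for (G‴)_N at composite `N`

Cell `bsd-wall`, lead prover `bsd-wall-rtt-p3` g10 (2026-08-28). THEOREMS ONLY (no `def`, no `sorry`);
`--supports stmt-BirchSwinnertonDyer-20688`; BSD is not proved by this. Sequel to `…CuspSpanPotential` (the engine).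

SETTING (engine): `χ : Γ₀(N) → 𝔽₂` additive with a potential `φ` (`φ(γ v) = χ γ + φ v` on primitive vectors). By the reduction of
`bsd-wall-rtt-p3-w4` g2 (`cuspSpanEvenAtTwo_of_forall_b1_odd`) the node at an odd level `N` is (G‴)_N: an ADMISSIBLE `χ` (kills the
small traces and the `4^k`-classes) that kills `B₁` is zero; by the engine this is «`w ↦ φ(1, w)` is constant on each cusp class and the
symbol function vanishes on the mixed rows». The engine's `phi_one_one_sub_eq` is the `B₁`-MOVE `w ↦ w/(w+1)` (a translation
`z ↦ z + 1` of `z = 1/w`). This file records the moves supplied by the `4^k`-CLASSES (hypothesis `hkill`), which a proof of (G‴)_N at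
levels with three or more primes must use (at such levels the `B₁`-moves alone cannot suffice: `φ(105)/2 < 2 g(X₀(105))`):

* `phi_one_eq_of_mul_eq_four_pow_sub_one` — the **DILATION MOVE** `φ(1, w) = φ(1, δ)` whenever `b δ = 4^k − 1` (`k ≥ 1`) and
  `δ ≡ 4^k w (mod N)`: the `4^k`-class element `(1 − bw, b; δ − 4^k w, 4^k)` carries `(1, w)` to `(1, δ)`. With a divisor `δ` of
  `4^k − 1` in the class `4^k w` this is «`ν(w) = ν(4^k w)`» (for unit classes such divisors are `bsd-wall-rtt-p3-w5` g2's
  `exists_modEq_dvd_four_pow_sub_one`; for a non-unit `w` one needs `gcd(w, N) ∣ 4^k − 1`).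
* `phi_one_eq_of_mul_eq_neg_four_pow_add_one` — the signed variant: `b δ = −(4^k + 1)`, `δ ≡ 4^k w` gives `φ(1, w) = φ(1, −δ)`.
* `phi_one_eq_of_twoStep` — the **TWO-STEP MOVE** through a numerator-`x` cusp: a `4^k`-class element `(x − bw, b; y − 4^k w, 4^k)`
  (`b y = x·4^k − 1`, `y ≡ 4^k w (mod N)`) carries `(1, w)` to `(x, y)`, and a `B₁` element `(α, −1; Nκ, δ')` with `xα − y = ε = ±1`
  brings it back to `(ε, Nκx + δ'y)`; so `φ(1, w) = φ(1, ε(Nκx + δ'y))`, i.e. `z ↦ (4^{−k} z − ε)/x` on `z = 1/w` modulo the primes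
  of `N` not dividing `w`. (Example, level `255`, type `17`: `x = 13`, `b = 27`, `k = 5`, `y = 493 = 17·29`, `w ≡ 187`, `ε = −1`,
  `α = 38` links the two components left by the `B₁`-moves and the dilations — lead memo `Lines/birth-twoprimes.md` §3.)

References: [Manin1972] §1.5–1.7; [Rademacher1929] §1; [Pollack2003] Conj. 6.3 (the node served).
-/

set_option autoImplicit false
set_option linter.dupNamespace false

noncomputable section

open scoped MatrixGroups

open CongruenceSubgroup Literature.NumberTheory.EllipticCurves.ModularForms

namespace Summit.BirchSwinnertonDyer.BirchSwinnertonDyer.Theorems.SignedMuAtTwo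

namespace Potential

variable {N : ℕ} {χ : Gamma0 N → ZMod 2} {φ : ℤ → ℤ → ZMod 2}

/-- **Dilation move.** If `b δ = 4^k − 1` (`k ≥ 1`) and `N ∣ δ − 4^k w`, then `φ(1, δ) = φ(1, w)`: the element
`(1 − bw, b; δ − 4^k w, 4^k) ∈ Γ₀(N)` has lower-right entry `4^k` (killed by `hkill`) and maps `(1, w)` to `(1, δ)`.
[cite: Pollack2003, Conj. 6.3] -/
theorem phi_one_eq_of_mul_eq_four_pow_sub_one
    (hφ : ∀ (γ : Gamma0 N) (x y : ℤ), IsCoprime x y →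
      φ ((γ : SL(2, ℤ)) 0 0 * x + (γ : SL(2, ℤ)) 0 1 * y) ((γ : SL(2, ℤ)) 1 0 * x + (γ : SL(2, ℤ)) 1 1 * y) = χ γ + φ x y)
    (hkill : ∀ γ : Gamma0 N, (∃ k : ℕ, 1 ≤ k ∧ ((γ : SL(2, ℤ)) 1 1).natAbs = 4 ^ k) → χ γ = 0)
    {w δ b : ℤ} {k : ℕ} (hk : 1 ≤ k) (hb : b * δ = 4 ^ k - 1) (hδ : (N : ℤ) ∣ δ - 4 ^ k * w) :
    φ 1 δ = φ 1 w := by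
  obtain ⟨γ, h00, h01, h10, h11⟩ := ThetaLayerLambdaCongruenceAtTwo.exists_gamma0_entries (N := N)
    (1 - b * w) b (δ - 4 ^ k * w) (4 ^ k) (by linear_combination -hb) hδ
  have hχ : χ γ = 0 := hkill γ ⟨k, hk, by rw [h11]; exact_mod_cast Int.natAbs_pow 4 k⟩
  have h := hφ γ 1 w isCoprime_one_left
  rw [h00, h01, h10, h11, hχ, zero_add] at h
  have e1 : (1 - b * w) * 1 + b * w = 1 := by ring
  have e2 : (δ - 4 ^ k * w) * 1 + 4 ^ k * w = δ := by ring
  rwa [e1, e2] at h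

/-- **Signed dilation move.** If `b δ = −(4^k + 1)` (`k ≥ 1`) and `N ∣ δ − 4^k w`, then `φ(1, −δ) = φ(1, w)`: the `4^k`-class
element `(−1 − bw, b; δ − 4^k w, 4^k)` maps `(1, w)` to `(−1, δ)`, and `φ` is even. [cite: Pollack2003, Conj. 6.3] -/
theorem phi_one_eq_of_mul_eq_neg_four_pow_add_one
    (hsmall : ∀ γ : Gamma0 N, ((γ : SL(2, ℤ)) 0 0 + (γ : SL(2, ℤ)) 1 1).natAbs ≤ 2 → χ γ = 0)
    (hφ : ∀ (γ : Gamma0 N) (x y : ℤ), IsCoprime x y →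
      φ ((γ : SL(2, ℤ)) 0 0 * x + (γ : SL(2, ℤ)) 0 1 * y) ((γ : SL(2, ℤ)) 1 0 * x + (γ : SL(2, ℤ)) 1 1 * y) = χ γ + φ x y)
    (hkill : ∀ γ : Gamma0 N, (∃ k : ℕ, 1 ≤ k ∧ ((γ : SL(2, ℤ)) 1 1).natAbs = 4 ^ k) → χ γ = 0)
    {w δ b : ℤ} {k : ℕ} (hk : 1 ≤ k) (hb : b * δ = -(4 ^ k + 1)) (hδ : (N : ℤ) ∣ δ - 4 ^ k * w) :
    φ 1 (-δ) = φ 1 w := by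
  obtain ⟨γ, h00, h01, h10, h11⟩ := ThetaLayerLambdaCongruenceAtTwo.exists_gamma0_entries (N := N)
    (-1 - b * w) b (δ - 4 ^ k * w) (4 ^ k) (by linear_combination -hb) hδ
  have hχ : χ γ = 0 := hkill γ ⟨k, hk, by rw [h11]; exact_mod_cast Int.natAbs_pow 4 k⟩
  have h := hφ γ 1 w isCoprime_one_left
  rw [h00, h01, h10, h11, hχ, zero_add] at h
  have e1 : (-1 - b * w) * 1 + b * w = -1 := by ring
  have e2 : (δ - 4 ^ k * w) * 1 + 4 ^ k * w = δ := by ring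
  rw [e1, e2] at h
  -- `φ(−1, δ) = φ(1, −δ)`
  have hn := phi_neg hsmall hφ (x := 1) (y := -δ) isCoprime_one_left
  rw [neg_neg] at hn
  rw [← hn, h]

/-- **Two-step move** (through the numerator-`x` cusp `x/y`). Data: `b y = x 4^k − 1` (`k ≥ 1`), `N ∣ y − 4^k w` — so the
`4^k`-class element `(x − bw, b; y − 4^k w, 4^k)` carries `(1, w)` to `(x, y)` — and a `B₁` element `(α, −1; Nκ, δ')`
(`α δ' + N κ = 1`) with `x α − y = ε`, `ε = ±1`, carrying `(x, y)` to `(ε, Nκx + δ'y)`. Then `φ(1, w) = φ(1, ε(Nκx + δ'y))`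
(`χ` kills the `4^k`-classes and `B₁`; `φ` is even). [cite: Manin1972, §1.6] [cite: Pollack2003, Conj. 6.3] -/
theorem phi_one_eq_of_twoStep
    (hsmall : ∀ γ : Gamma0 N, ((γ : SL(2, ℤ)) 0 0 + (γ : SL(2, ℤ)) 1 1).natAbs ≤ 2 → χ γ = 0)
    (hφ : ∀ (γ : Gamma0 N) (x y : ℤ), IsCoprime x y →
      φ ((γ : SL(2, ℤ)) 0 0 * x + (γ : SL(2, ℤ)) 0 1 * y) ((γ : SL(2, ℤ)) 1 0 * x + (γ : SL(2, ℤ)) 1 1 * y) = χ γ + φ x y)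
    (hkill : ∀ γ : Gamma0 N, (∃ k : ℕ, 1 ≤ k ∧ ((γ : SL(2, ℤ)) 1 1).natAbs = 4 ^ k) → χ γ = 0)
    (hB1 : ∀ β : Gamma0 N, (β : SL(2, ℤ)) 0 1 = -1 → χ β = 0)
    {w x y b α δ' κ ε : ℤ} {k : ℕ} (hk : 1 ≤ k) (hby : b * y = x * 4 ^ k - 1) (hy : (N : ℤ) ∣ y - 4 ^ k * w)
    (hα : α * δ' + N * κ = 1) (hxα : x * α - y = ε) (hε : ε = 1 ∨ ε = -1) :
    φ 1 w = φ 1 (ε * ((N : ℤ) * κ * x + δ' * y)) := by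
  -- the `4^k`-class element `γ : (1, w) ↦ (x, y)`
  obtain ⟨γ, g00, g01, g10, g11⟩ := ThetaLayerLambdaCongruenceAtTwo.exists_gamma0_entries (N := N)
    (x - b * w) b (y - 4 ^ k * w) (4 ^ k) (by linear_combination -hby) hy
  have hχγ : χ γ = 0 := hkill γ ⟨k, hk, by rw [g11]; exact_mod_cast Int.natAbs_pow 4 k⟩
  have hγ := hφ γ 1 w isCoprime_one_left
  rw [g00, g01, g10, g11, hχγ, zero_add] at hγ
  have e1 : (x - b * w) * 1 + b * w = x := by ring
  have e2 : (y - 4 ^ k * w) * 1 + 4 ^ k * w = y := by ring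
  rw [e1, e2] at hγ
  -- `(x, y)` is primitive
  have hε2 : ε * ε = 1 := by rcases hε with rfl | rfl <;> norm_num
  have hxy : IsCoprime x y := ⟨ε * α, -ε, by linear_combination ε * hxα + hε2⟩
  -- the `B₁` element `β : (x, y) ↦ (ε, Nκx + δ'y)`
  obtain ⟨β, b00, b01, b10, b11⟩ := ThetaLayerLambdaCongruenceAtTwo.exists_gamma0_entries (N := N)
    α (-1) (N * κ) δ' (by linear_combination hα) (dvd_mul_right _ _)
  have hχβ : χ β = 0 := hB1 β b01
  have hβ := hφ β x y hxy
  rw [b00, b01, b10, b11, hχβ, zero_add] at hβ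
  have e3 : α * x + -1 * y = ε := by linear_combination hxα
  rw [e3] at hβ
  -- `φ(ε, t) = φ(1, ε t)`
  rw [← hγ, ← hβ]
  rcases hε with rfl | rfl
  · rw [one_mul]
  · rw [neg_one_mul]
    have hn := phi_neg hsmall hφ (x := 1) (y := -((N : ℤ) * κ * x + δ' * y)) isCoprime_one_left
    rw [neg_neg] at hn
    exact hn

end Potential

end Summit.BirchSwinnertonDyer.BirchSwinnertonDyer.Theorems.SignedMuAtTwo

end
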